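import Literature.NumberTheory.GaloisRepresentations.LocalCyclicLayerClassModule
import Literature.Algebra.Homology.SecondInequalityQuotientLayer
import Literature.Algebra.Homology.BrauerGroupInflationRestriction
import Literature.Algebra.Homology.CohomologicalTrivialityCriterion
import HarnessLib

/-!
# The local second inequality `|H²(Gal(L/K), Lˣ)| ∣ [L : K]` for EVERY finite Galois extension of a
# non-archimedean local field, via the engine's dévissage — in Mathlib's `groupCohomology`
# (Serre, *Local Fields* XIII §3 Prop. 6; Neukirch, *Bonn Lectures* II §5 Lemma (5.1))

Topic `NumberTheory/GaloisRepresentations` (local class field theory); namespace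
`Literature.NumberTheory.GaloisRepresentations.UnitsLayer`.  Proof file: theorems only (no definition,
no named fact, no instance, no notation, no `sorry`; D-0026).  Sequel of `LocalCyclicLayerClassModule`
(`natCard_H2_units_eq_finrank`: `|H²(Gal(L/K), Lˣ)| = [L:K]` for CYCLIC layers of a non-archimedean local
field; `isZero_H1_res_units`: Hilbert 90 on every subgroup) feeding the engine's dévissage
`Literature/Algebra/Homology/SecondInequalityDevissage` (`SecondInequality.Hypotheses A` ⟹
`|H²(U, A)| ∣ |U|`, Neukirch II §5 (5.1): "The general case follows from this by purely
cohomological methods") with its transport-of-structure file `SecondInequalityQuotientLayer`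
(`LayerTransport.natCard_quotient_congr`).

* **`secondInequalityHypotheses_units :
  SecondInequality.Hypotheses (Rep.ofAlgebraAutOnUnits K L)`** for EVERY finite Galois `L/K`
  (Axiom I = Hilbert 90 on every sub-layer, the engine's `InflationRestriction.isZero_H1_res_units`;
  the prime-cyclic bound = the local class field axiom at the cyclic layer `M/M'` of PRIME degree over
  the local field `M'` — transport of structure `LayerTransport.natCard_quotient_congr` along
  `H ≃* Gal(L/L^{f(H)})`, the engine's `InflationRestriction.quotientInvariantsUnitsCohomologyIso`
  (Serre X §4 Prop. 6: `(Lˣ)^S = (L^S)ˣ`, `G/S ≅ G(L^S/k)`), and `LocalCyclicLayerClassModule.natCard_H2_units_eq_card`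
  with `FiniteExtension.isNonarchimedeanLocalField`), hence **`natCard_H2_units_dvd_finrank`:
  `|H²(Gal(L/K), Lˣ)| ∣ [L : K]`** (`|Br(L/K)|` divides `[L:K]` — the local second inequality, Serre
  XIII §3 Prop. 6, "order dividing `n`" half) and `natCard_H2_res_units_dvd_card` (`|H²(U, Lˣ)| ∣ |U|`
  for every subgroup).

What this is NOT: equality `|H²(Gal(L/K), Lˣ)| = [L:K]` for NON-cyclic layers and the invariant map
(Neukirch II §5 Thm. (5.2)/(5.6): needs the unramified layers, the engine's
`Unramified.HasUnramifiedComposita`, not supplied here).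

## References
* J.-P. Serre, *Local Fields*, GTM 67 (1979), XI §1 (iv), XIII §3 Prop. 6. [SerreLocalFields1979]
* J. Neukirch, *Class Field Theory — The Bonn Lectures* (2013), II §5 Lemma (5.1). [Neukirch2013]
-/

noncomputable section

open CategoryTheory CategoryTheory.Limits groupCohomology

namespace Literature.NumberTheory.GaloisRepresentations

namespace UnitsLayer

open Literature.Algebra.Homology

/-! ## `K` a non-archimedean local field: `SecondInequality.Hypotheses (Lˣ)` and
`|H²(Gal(L/K), Lˣ)| ∣ [L : K]` for every finite Galois `L/K` -/

section LocalField

variable (K : Type) [Field K] [ValuativeRel K] [TopologicalSpace K] [IsNonarchimedeanLocalField K]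
variable (L : Type) [Field L] [Algebra K L] [FiniteDimensional K L] [IsGalois K L]

/-- **The hypotheses of the second-inequality dévissage hold for `(Gal(L/K), Lˣ)`, `L/K` any finite
Galois extension of a non-archimedean local field**: (I) `H¹(H, Lˣ) = 0` along every injective
`H →* Gal(L/K)` (Hilbert 90 on the layer `L/L^H`), (C) `|H²(H ⧸ N, (Lˣ)^N)| ∣ [H:N]` for `N ⊴ H` of
prime index — the quotient layer is the CYCLIC layer `M/M'` of prime degree over the local field
`M' = L^H`, where `|H²| = [M:M']` is the local class field axiom (`natCard_H2_units_eq_finrank`).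
[cite: Neukirch2013, Part II §5 Lemma (5.1) (proof)][cite: SerreLocalFields1979, Ch. XIII §3 Prop. 6] -/
theorem secondInequalityHypotheses_units :
    SecondInequality.Hypotheses (Rep.ofAlgebraAutOnUnits K L) where
  isZero_H1 H _ _ f hf :=
    CohomologicalTriviality.isZero_res_of_forall_subgroup (Rep.ofAlgebraAutOnUnits K L) 1
      (fun U => InflationRestriction.isZero_H1_res_units K L U) f hf
  natCard_H2_quotient_dvd H _ _ f hf N _ hN := by
    classical
    -- the layer `M/M'`, `M' = L^{f(H)}` a local field, `M = L^{e(N)}`, `e : H ≃* Gal(L/M')`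
    set M' := IntermediateField.fixedField f.range with hM'
    set e : H ≃* (L ≃ₐ[M'] L) :=
      (MonoidHom.ofInjective hf).trans (IntermediateField.subgroupEquivAlgEquiv f.range) with he
    haveI hN' : (N.map e.toMonoidHom).Normal := Subgroup.Normal.map inferInstance _ e.surjective
    set M := IntermediateField.fixedField (N.map e.toMonoidHom) with hM
    haveI : IsGalois M' L := IsGalois.tower_top_of_isGalois K M' L
    -- transport of structure `(H, Res_f Lˣ, N) ≅ (Gal(L/M'), Lˣ, e(N))` (Serre XI §1 (iv)), then the
    -- quotient layer of the units module is the units module of the fixed field (Serre X §4 Prop. 6)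
    rw [LayerTransport.natCard_quotient_congr e (Rep.res f (Rep.ofAlgebraAutOnUnits K L))
      (Rep.ofAlgebraAutOnUnits M' L) (@LinearEquiv.refl ℤ (Additive Lˣ) _ _ (AddCommGroup.toIntModule _))
      (fun g => LinearMap.ext fun x => congrArg Additive.ofMul (Units.ext rfl)) N (N.map e.toMonoidHom)
      rfl 2,
      Nat.card_congr (InflationRestriction.quotientInvariantsUnitsCohomologyIso M' L
        (N.map e.toMonoidHom) 2).toLinearEquiv.toEquiv]
    letI := FiniteExtension.valuativeRel K M'
    letI := FiniteExtension.topologicalSpace K M'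
    haveI := FiniteExtension.isNonarchimedeanLocalField K M'
    haveI : Fact N.index.Prime := ⟨hN⟩
    -- `Gal(M/M') ≅ Gal(L/M') ⧸ e(N) ≅ H ⧸ N` has prime order, hence is cyclic
    have hcard : Nat.card (M ≃ₐ[M'] M) = N.index := by
      rw [← Nat.card_congr (IsGalois.normalAutEquivQuotient (N.map e.toMonoidHom)).toEquiv,
        ← Nat.card_congr (QuotientGroup.congr N (N.map e.toMonoidHom) e rfl).toEquiv,
        Subgroup.index_eq_card]
    haveI : IsCyclic (M ≃ₐ[M'] M) := isCyclic_of_prime_card hcard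
    rw [natCard_H2_units_eq_card M' M, hcard]

/-- **The local second inequality: `|H²(Gal(L/K), Lˣ)| ∣ [L : K]`** for EVERY finite Galois extension
`L/K` of a non-archimedean local field (`|Br(L/K)|` divides `[L:K]`; the engine's dévissage
`SecondInequality.natCard_H2_dvd_card` over the Sylow subgroups and prime-cyclic quotient layers).
[cite: SerreLocalFields1979, Ch. XIII §3 Prop. 6][cite: Neukirch2013, Part II §5 Lemma (5.1)] -/
theorem natCard_H2_units_dvd_finrank :
    Nat.card (groupCohomology (Rep.ofAlgebraAutOnUnits K L) 2) ∣ Module.finrank K L := by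
  rw [← IsGalois.card_aut_eq_finrank]
  exact SecondInequality.natCard_H2_dvd_card (secondInequalityHypotheses_units K L)

/-- `|H²(U, Lˣ)| ∣ |U|` for every subgroup `U ≤ Gal(L/K)` (every layer `L/L^U`).
[cite: Neukirch2013, Part II §5 Lemma (5.1)] -/
theorem natCard_H2_res_units_dvd_card (U : Subgroup (L ≃ₐ[K] L)) :
    Nat.card (groupCohomology (Rep.res U.subtype (Rep.ofAlgebraAutOnUnits K L)) 2) ∣ Nat.card U :=
  SecondInequality.natCard_H2_res_dvd_card (secondInequalityHypotheses_units K L) U.subtype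
    U.subtype_injective

end LocalField

end UnitsLayer

end Literature.NumberTheory.GaloisRepresentations

end
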